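import Summits.ResolutionOfSingularities.ResolutionOfSingularities.Theses.WildQuotients
import Literature.AlgebraicGeometry.Resolution.Alterations
import HarnessLib

/-!
# WildQuotients / `GaloisQuotientAlteration` — lower bound (item stmt-ResolutionOfSingularities-16323)

Calibration of the support item `GaloisQuotientAlteration` of route
`ResolutionOfSingularities/WildQuotients`: whatever proves it proves de Jong's regular alteration
theorem (de Jong 1996, Thm. 4.1, in the tree's weak form `DeJong1996`: an alteration with regular
source) for every integral separated scheme of finite type over a field of PRIME characteristic —
compose the finite quotient map `q : X' → X₁` with the purely inseparable alteration `φ : X₁ → X`.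
Together with `galoisQuotientAlteration_of_deJong1997` (the item from de Jong 1997, Thm. 5.13 /
Cor. 5.15, `DeJong1997_galoisAlterationQuasiProjective`) this brackets the item between de Jong's
two alteration theorems in characteristic `p`: it is not cheaper than `DeJong1996` restricted to
prime characteristic, whose in-tree programme is open.
-/

noncomputable section

set_option linter.dupNamespace false -- mandated namespace of this single-conjunct summit

namespace Summit.ResolutionOfSingularities.ResolutionOfSingularities.Theorems

open CategoryTheory AlgebraicGeometry TopologicalSpace
open Literature.AlgebraicGeometry.Resolution

/-- **Lower bound for `GaloisQuotientAlteration`: it yields regular alterations in every prime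
characteristic** (the conclusion of de Jong 1996, Thm. 4.1 = the tree's `DeJong1996`, for fields of
characteristic `p`). From the data `q : X' → X₁` (finite, surjective) and `φ : X₁ → X` (proper,
surjective, finite over a dense open `V`) of the item, `q ≫ φ : X' → X` is proper, dominant and
finite over the non-empty open `V`, with `X'` integral and regular. [folklore; de Jong 1996, 2.20] -/
theorem exists_isAlteration_isRegular_of_galoisQuotientAlteration
    (h : Summit.ResolutionOfSingularities.ResolutionOfSingularities.Theses.WildQuotients.GaloisQuotientAlteration)
    {p : ℕ} (hp : p.Prime) (k : Type) [Field k] [CharP k p] (X : Scheme.{0}) [IsIntegral X]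
    (f : X ⟶ Spec (.of k)) [IsSeparated f] [LocallyOfFiniteType f] [QuasiCompact f] :
    ∃ (X' : Scheme.{0}) (π : X' ⟶ X), IsAlteration π ∧ Scheme.IsRegular X' := by
  obtain ⟨X', X₁, q, φ, G, _, _, ρ, -, -, -, _, hX', hreg, hq, hqsurj, -, -, -, hφ, hφsurj, V, hV,
    hVfin, -⟩ := h p hp k X f ‹_› ‹_› ‹_› ‹_›
  haveI := hX'
  haveI := hq
  haveI := hφ
  haveI : Surjective q := ⟨hqsurj⟩
  haveI : Surjective φ := ⟨hφsurj⟩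
  refine ⟨X', q ≫ φ, ⟨hX', inferInstance, inferInstance, V, hV.nonempty, ?_⟩, hreg⟩
  have h1 : IsFinite (q ∣_ φ ⁻¹ᵁ V) := inferInstance
  have h2 : IsFinite (φ ∣_ V) := hVfin
  rw [morphismRestrict_comp]
  exact MorphismProperty.comp_mem _ _ _ h1 h2

end Summit.ResolutionOfSingularities.ResolutionOfSingularities.Theorems

end
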